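import Mathlib

/-!
# Characters at a split place: the `(t, t⁻¹)` dictionary

Tier-5 support for row E10 of §N4.1.4 (route/T5-N4.1-route-1.md): at a place `v` of `F` that
splits in the quadratic extension `E`, one has `E_v = F_v × F_v`, the conjugation is the swap
`(z₁, z₂) ↦ (z₂, z₁)`, and

* a character `η` of `E_v^× = F_v^× × F_v^×` trivial on the diagonal `F_v^×` has components
  `(t, t⁻¹)`: `η (a, b) = η₁ a / η₁ b` with `η₁ := η (·, 1)` — and conversely;
* the norm-one torus `{z : z z̄ = 1}` is `{(t, t⁻¹)}`;
* `z / z̄ = (z₁ / z₂, z₂ / z₁)`, so for a character `β` of the norm-one torus the character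
  `β̃ (z) := β (z / z̄)` has components `(β′, β′⁻¹)` with `β′ t := β (t, t⁻¹)`.

Everything is stated for an arbitrary commutative group `G` in place of `F_v^×` and an arbitrary
commutative group `M` of values (`ℂ^×`); nothing here mentions a field, a place or an
automorphic form.  Uses an L-value-free non-vanishing device: NO.
-/

namespace Summit.Ventures.HodgeRepro2.T5SplitPlaceCharacters

variable {G M : Type*} [CommGroup G] [CommGroup M]

/-! ### 1. Characters of `G × G` trivial on the diagonal -/

/-- A character of `G × G` is the product of its two restrictions. -/
theorem apply_eq_mul (η : G × G →* M) (a b : G) : η (a, b) = η (a, 1) * η (1, b) := by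
  rw [← map_mul, Prod.mk_mul_mk, mul_one, one_mul]

/-- If `η` is trivial on the diagonal, its second restriction is the inverse of the first. -/
theorem apply_one_left_eq_inv (η : G × G →* M) (h : ∀ x : G, η (x, x) = 1) (b : G) :
    η (1, b) = (η (b, 1))⁻¹ := by
  rw [eq_inv_iff_mul_eq_one, ← map_mul, Prod.mk_mul_mk, one_mul, mul_one]
  exact h b

/-- «the components are `(t, t⁻¹)`»: a character of `G × G` trivial on the diagonal is
`(a, b) ↦ η₁ a / η₁ b` with `η₁ := η (·, 1)`. -/
theorem apply_eq_div (η : G × G →* M) (h : ∀ x : G, η (x, x) = 1) (a b : G) :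
    η (a, b) = η (a, 1) / η (b, 1) := by
  rw [apply_eq_mul η a b, apply_one_left_eq_inv η h b, div_eq_mul_inv]

/-- The first restriction of a character of `G × G`, as a character of `G`. -/
theorem comp_inl_apply (η : G × G →* M) (a : G) : η.comp (MonoidHom.inl G G) a = η (a, 1) := rfl

/-- Conversely, `(a, b) ↦ η₁ a / η₁ b` is trivial on the diagonal. -/
theorem diag_eq_one_of_forall_eq_div (η : G × G →* M) (η₁ : G →* M)
    (h : ∀ a b : G, η (a, b) = η₁ a / η₁ b) (x : G) : η (x, x) = 1 := by
  rw [h, div_self']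

/-- A character of `G × G` is trivial on the diagonal iff it is of the form
`(a, b) ↦ η₁ a / η₁ b` for a character `η₁` of `G`. -/
theorem forall_diag_eq_one_iff (η : G × G →* M) :
    (∀ x : G, η (x, x) = 1) ↔ ∃ η₁ : G →* M, ∀ a b : G, η (a, b) = η₁ a / η₁ b :=
  ⟨fun h => ⟨η.comp (MonoidHom.inl G G), fun a b => apply_eq_div η h a b⟩,
    fun ⟨η₁, h⟩ => diag_eq_one_of_forall_eq_div η η₁ h⟩

/-- The character `η₁` is determined by `η`: it is the first restriction. -/
theorem eq_comp_inl_of_forall_eq_div (η : G × G →* M) (η₁ : G →* M)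
    (h : ∀ a b : G, η (a, b) = η₁ a / η₁ b) : η₁ = η.comp (MonoidHom.inl G G) := by
  ext a
  rw [comp_inl_apply, h a 1, map_one, div_one]

/-! ### 2. The norm-one torus and the conjugation at a split place -/

/-- The «conjugation» at a split place is the swap; `z z̄` is diagonal. -/
theorem mul_swap (z : G × G) : z * z.swap = (z.1 * z.2, z.1 * z.2) := by
  ext <;> simp [mul_comm]

/-- `z / z̄ = (z₁ / z₂, z₂ / z₁)`. -/
theorem div_swap (z : G × G) : z / z.swap = (z.1 / z.2, z.2 / z.1) := by
  ext <;> simp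

/-- «the norm-one torus is `{(t, t⁻¹)}`»: `z z̄ = 1 ↔ z = (t, t⁻¹)` for `t = z₁`. -/
theorem mul_swap_eq_one_iff (z : G × G) : z * z.swap = 1 ↔ z = (z.1, z.1⁻¹) := by
  rw [mul_swap]
  constructor
  · intro h
    have h1 : z.1 * z.2 = 1 := congrArg Prod.fst h
    exact Prod.ext rfl (eq_inv_of_mul_eq_one_right h1)
  · intro h
    have h2 : z.2 = z.1⁻¹ := congrArg Prod.snd h
    rw [h2, mul_inv_cancel]
    rfl

/-- `z / z̄` lies on the norm-one torus. -/
theorem div_swap_mul_swap (z : G × G) : (z / z.swap) * (z / z.swap).swap = 1 := by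
  ext <;> simp [div_eq_mul_inv, mul_comm, mul_left_comm]

/-- `z / z̄ = (t, t⁻¹)` with `t = z₁ / z₂`. -/
theorem div_swap_eq (z : G × G) : z / z.swap = (z.1 / z.2, (z.1 / z.2)⁻¹) := by
  rw [div_swap, inv_div]

/-! ### 3. The character `β̃ (z) := β (z / z̄)` has components `(β′, β′⁻¹)` -/

/-- For a character `β` of `G × G` (restricted, in the application, to the norm-one torus),
`β (z / z̄) = β′ z₁ / β′ z₂` with `β′ t := β (t, t⁻¹)`. -/
theorem apply_div_swap (β : G × G →* M) (z : G × G) :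
    β (z / z.swap) = β (z.1, z.1⁻¹) / β (z.2, z.2⁻¹) := by
  rw [← map_div, div_swap]
  congr 1
  ext <;> simp [div_eq_mul_inv, mul_comm]

/-- `t ↦ (t, t⁻¹)`, as a character `G →* G × G`. -/
theorem normOne_apply (t : G) :
    ((MonoidHom.id G).prod (MonoidHom.id G)⁻¹) t = (t, t⁻¹) := rfl

/-- `β̃ := β ∘ (z ↦ z / z̄)` is a character of `G × G` whose components are `(β′, β′⁻¹)`,
`β′ := β ∘ (t ↦ (t, t⁻¹))`: it is `(a, b) ↦ β′ a / β′ b`, hence trivial on the diagonal. -/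
theorem comp_div_swap_apply (β : G × G →* M) (a b : G) :
    (β.comp ((MonoidHom.id (G × G)) / (MulEquiv.prodComm : G × G ≃* G × G).toMonoidHom)) (a, b) =
      (β.comp ((MonoidHom.id G).prod (MonoidHom.id G)⁻¹)) a /
        (β.comp ((MonoidHom.id G).prod (MonoidHom.id G)⁻¹)) b := by
  simp only [MonoidHom.comp_apply, MonoidHom.div_apply, MonoidHom.id_apply,
    MulEquiv.coe_toMonoidHom, normOne_apply]
  exact apply_div_swap β (a, b)

/-- `β̃` is trivial on the diagonal. -/
theorem comp_div_swap_diag (β : G × G →* M) (x : G) :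
    (β.comp ((MonoidHom.id (G × G)) / (MulEquiv.prodComm : G × G ≃* G × G).toMonoidHom)) (x, x) = 1 := by
  rw [comp_div_swap_apply, div_self']

end Summit.Ventures.HodgeRepro2.T5SplitPlaceCharacters
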